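import Summits.ABC.ABC.Theses.FeketeScales
import Summits.ABC.ABC.Theorems.PrimePowerRadical.Negative.Orders
import Literature.NumberTheory.DiophantineGeometry.AbcPrimePowerFamily
import HarnessLib

/-!
# Route FeketeScales — crux `SparseGoodScales` (stmt-ABC-2161): the Wieferich floor

Helper file (`--supports stmt-ABC-2161`) for the crux `SparseGoodScales` of route `FeketeScales`
("abc along SOME unbounded sequence of radical scales": for every `δ > 0` there are arbitrarily
large `R` with `c ≤ R^{1+δ}` for every abc triple of radical `≤ R`).  It lands a kernel-checked
HARDNESS FLOOR for the crux as filed, independent of any line: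

* `sparseGoodScales_infinite_wieferichLevel_lt_of_goodScales` — THE LEVEL LADDER: good scales for
  ONE exponent `1 + δ` at arbitrarily large `R` already force, for every prime base `q` and every
  integer `n > 1 + δ`, infinitely many primes `p` of Wieferich level `W_p(q) < n`
  (`W_p(q) = v_p(q^{2(p−1)} − 1)`, `Theorems/PrimePowerRadical/Negative/WieferichValuations`), i.e.
  with `p^n ∤ q^{p−1} − 1` for odd `p ∤ q`;
* `sparseGoodScales_infinite_not_isWieferich_of_goodScales` — rung `n = 2`: one exponent
  `δ < 1` forces infinitely many NON-WIEFERICH primes to every prime base;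
* `sparseGoodScales_imp_infinite_wieferichLevel_le` and
  `sparseGoodScales_imp_infinite_not_isWieferich` — hence the crux implies, for every prime `q`,
  `{p | p.Prime ∧ ¬ IsWieferich q p}.Infinite` and the whole ladder `{p | W_p(q) ≤ E}.Infinite`,
  `E ≥ 1`.

The rung `n = 2` is the conclusion Silverman derived from the full abc conjecture (J. Number
Theory 30 (1988), Thm 1); it is OPEN unconditionally in every base (already `q = 2`: "are there
infinitely many non-Wieferich primes?"), and so is every bounded-level rung.  Consequences for the
crux: (i) any proof of stmt-ABC-2161 — by whatever line — proves the infinitude of non-Wieferich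
primes in every prime base; (ii) no single instance `SGS_δ` (fixed `δ`, however large) is provable
without settling the bounded-level Wieferich problem at level `⌊1 + δ⌋`.  This is the formal
content of BarrierNotes-r1-k1 B6 / r1-k2 N1(b) ("no instance of the crux is a theorem") for the
crux itself, in the currency of a named open problem rather than of Stewart–Yu.

Mechanism (De Leon / Silverman, made scale-dense).  If all odd primes `p > P₀` were of level `≥ n`
to base `q`, every large odd prime factor of `q^k − 1` would occur to the `n`-th power
(`prod_pow_dvd_of_levels_ge`, `radical_dvd_prod_large` of `Theorems/PrimePowerRadical/Negative/`),
so `rad(1·(q^{nj}−1)·q^{nj}) ≤ M·q^j` with `M = 2·q·∏_{p ≤ P₀} p` for EVERY `j ≥ 1`: the abc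
triples `(1, q^{nj} − 1, q^{nj})` have quality `→ n` and radicals in geometric progression of ratio
`q`, so their shadows cover every large scale — at a good scale `R` take `q^j ≤ R/M < q^{j+1}`;
the triple has radical `≤ R`, hence `q^{nj} ≤ R^{1+δ}`, while `R < M q^{j+1}` gives
`R^n < (Mq)^n q^{nj} ≤ (Mq)^n R^{1+δ}`, i.e. `R^{n−1−δ} < (Mq)^n` — false for large `R`.  No window
is needed because the family is dense in scale; this is exactly what the windowed residue WGS of
line `Sketch` cannot see (its radicals may fall below the window) and what the crux as filed pays.
-/

-- `Summit.<Summit>.<Problem>` is the mandated summit-side namespace (CONVENTIONS §2); for the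
-- single-conjunct summit `ABC` the two coincide, so the duplicate `ABC.ABC` is deliberate.
set_option linter.dupNamespace false

noncomputable section

namespace Summit.ABC.ABC.Theorems

open Literature.NumberTheory.DiophantineGeometry UniqueFactorizationMonoid
open Summit.ABC.ABC.Theses.FeketeScales
open Summit.ABC.ABC.Theorems.PrimePowerRadical.Negative

/-- **High levels force small radicals along the subfamily `k = nj`.**  If every odd prime
`p > P₀` dividing some `q^k − 1` has Wieferich level `≥ n` to the prime base `q` (`n ≥ 1`), then
for every `j ≥ 1`, `rad(1·(q^{nj} − 1)·q^{nj}) ≤ 2·(∏_{p ≤ P₀ prime} p)·q · q^j`: the product `R'`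
of the large odd prime factors satisfies `R'^n ∣ q^{nj} − 1`, so `R' ≤ q^j`, and
`rad(q^{nj} − 1) ∣ (∏_{p ≤ P₀} p)·2·R'`. [cite: Silverman1988, Thm 1] -/
theorem sparseGoodScales_rad_family_le_of_levels_ge {q n : ℕ} (hq : q.Prime) (hn : 1 ≤ n)
    (P₀ : ℕ)
    (hW : ∀ k p : ℕ, p.Prime → p ≠ 2 → P₀ < p → p ∣ q ^ k - 1 → n ≤ wieferichLevel q p)
    (j : ℕ) (hj : 1 ≤ j) :
    rad 1 (q ^ (n * j) - 1) (q ^ (n * j)) ≤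
      2 * (∏ p ∈ (Finset.range (P₀ + 1)).filter Nat.Prime, p) * q * q ^ j := by
  have hk : 1 ≤ n * j := Nat.one_le_iff_ne_zero.mpr (Nat.mul_ne_zero (by omega) (by omega))
  set P : ℕ := ∏ p ∈ (Finset.range (P₀ + 1)).filter Nat.Prime, p with hP
  set R' : ℕ := ∏ p ∈ ((q ^ (n * j) - 1).primeFactors.erase 2).filter (fun p => P₀ < p), p
    with hR'
  have h1 : R' ^ n ∣ q ^ (n * j) - 1 := prod_pow_dvd_of_levels_ge hq.two_le hk (hW (n * j))
  have h2 : radical (q ^ (n * j) - 1) ∣ P * 2 * R' := radical_dvd_prod_large q (n * j) P₀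
  have hqk : 2 ≤ q ^ (n * j) := two_le_pow_of_two_le hq.two_le hk
  -- `R' ≤ q^j`
  have hR'pow : R' ^ n ≤ (q ^ j) ^ n := by
    calc R' ^ n ≤ q ^ (n * j) - 1 := Nat.le_of_dvd (by omega) h1
      _ ≤ q ^ (n * j) := Nat.sub_le _ _
      _ = (q ^ j) ^ n := by rw [← pow_mul, mul_comm]
  have hR'le : R' ≤ q ^ j := (Nat.pow_le_pow_iff_left (by omega : n ≠ 0)).mp hR'pow
  have hP0 : P ≠ 0 :=
    Finset.prod_ne_zero_iff.mpr fun p hp => (Finset.mem_filter.mp hp).2.ne_zero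
  have hR'0 : R' ≠ 0 := Finset.prod_ne_zero_iff.mpr fun p hp =>
    (Nat.prime_of_mem_primeFactors (Finset.mem_of_mem_erase (Finset.mem_filter.mp hp).1)).ne_zero
  have hrad : radical (q ^ (n * j) - 1) ≤ P * 2 * R' :=
    Nat.le_of_dvd (Nat.pos_of_ne_zero (mul_ne_zero (mul_ne_zero hP0 two_ne_zero) hR'0)) h2
  rw [rad_one_pow_sub_one_pow hq hk]
  calc radical (q ^ (n * j) - 1) * q ≤ (P * 2 * R') * q := Nat.mul_le_mul_right q hrad
    _ ≤ (P * 2 * q ^ j) * q := Nat.mul_le_mul_right q (Nat.mul_le_mul_left _ hR'le)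
    _ = 2 * P * q * q ^ j := by ring

/-- **THE LEVEL LADDER OF A GOOD-SCALE SEQUENCE.**  If for some real `δ` there are arbitrarily
large scales `R` at which every abc triple of radical `≤ R` has `c ≤ R^{1+δ}`, then for every prime
`q` and every integer `n ≥ 1` with `1 + δ < n` there are infinitely many primes `p` of Wieferich
level `W_p(q) < n`.  Proof: otherwise all primes `p > P₀` have level `≥ n`, so
`sparseGoodScales_rad_family_le_of_levels_ge` gives `rad(1·(q^{nj}−1)·q^{nj}) ≤ M q^j` for all
`j ≥ 1` (`M = 2Pq`); at a good scale `R` choose `q^j ≤ R/M < q^{j+1}` (so `j ≥ 1` once `R ≥ Mq`):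
the triple has radical `≤ R`, hence `q^{nj} ≤ R^{1+δ}`, while `R < Mq·q^j` gives
`R^n < (Mq)^n · q^{nj} ≤ (Mq)^n · R^{1+δ}`, i.e. `R^{n−1−δ} < (Mq)^n`, false for
`R ≥ ((Mq)^n)^{1/(n−1−δ)}`. [cite: Silverman1988, Thm 1] -/
theorem sparseGoodScales_infinite_wieferichLevel_lt_of_goodScales {δ : ℝ} {n : ℕ} (hn1 : 1 ≤ n)
    (hn : 1 + δ < n)
    (h : ∀ N : ℕ, ∃ R : ℕ, N ≤ R ∧ ∀ a b c : ℕ, IsABCTriple a b c → rad a b c ≤ R →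
      (c : ℝ) ≤ (R : ℝ) ^ (1 + δ))
    (q : ℕ) (hq : q.Prime) : {p : ℕ | p.Prime ∧ wieferichLevel q p < n}.Infinite := by
  intro hfin
  obtain ⟨P₀, hP₀⟩ := hfin.bddAbove
  have hW : ∀ k p : ℕ, p.Prime → p ≠ 2 → P₀ < p → p ∣ q ^ k - 1 → n ≤ wieferichLevel q p := by
    intro k p hp _ hpP _
    by_contra hw
    have : p ≤ P₀ :=
      hP₀ (show p ∈ {p : ℕ | p.Prime ∧ wieferichLevel q p < n} from ⟨hp, lt_of_not_ge hw⟩)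
    omega
  set P : ℕ := ∏ p ∈ (Finset.range (P₀ + 1)).filter Nat.Prime, p with hP
  have hP0 : P ≠ 0 :=
    Finset.prod_ne_zero_iff.mpr fun p hp => (Finset.mem_filter.mp hp).2.ne_zero
  -- the scale constant `M = 2 P q`: `rad(T_{nj}) ≤ M q^j`
  set M : ℕ := 2 * P * q with hM
  have hq0 : 0 < q := hq.pos
  have hM0 : 0 < M := by
    rw [hM]; exact Nat.mul_pos (Nat.mul_pos two_pos (Nat.pos_of_ne_zero hP0)) hq0
  have hfam : ∀ j : ℕ, 1 ≤ j → rad 1 (q ^ (n * j) - 1) (q ^ (n * j)) ≤ M * q ^ j := by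
    intro j hj
    have := sparseGoodScales_rad_family_le_of_levels_ge hq hn1 P₀ hW j hj
    rw [hM]; exact this
  -- real constants: `K = (Mq)^n`, exponent `e = n − 1 − δ > 0`
  set K : ℝ := ((M * q : ℕ) : ℝ) ^ n with hK
  have hMq0 : (0 : ℝ) < ((M * q : ℕ) : ℝ) := by exact_mod_cast Nat.mul_pos hM0 hq0
  have hK0 : 0 < K := by rw [hK]; positivity
  set e : ℝ := (n : ℝ) - 1 - δ with he
  have he0 : 0 < e := by rw [he]; linarith
  obtain ⟨N₁, hN₁⟩ := exists_nat_gt (K ^ (1 / e))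
  -- a good scale beyond both thresholds
  obtain ⟨R, hRN, hgood⟩ := h (max N₁ (M * q))
  have hRN₁ : N₁ ≤ R := le_trans (le_max_left _ _) hRN
  have hRMq : M * q ≤ R := le_trans (le_max_right _ _) hRN
  -- `j := ⌊log_q (R / M)⌋ ≥ 1`
  have hRM : q ≤ R / M := (Nat.le_div_iff_mul_le hM0).mpr (by rw [mul_comm]; exact hRMq)
  set j : ℕ := Nat.log q (R / M) with hj
  have hj1 : 1 ≤ j := Nat.log_pos hq.one_lt hRM
  have hRM0 : R / M ≠ 0 := by have := hq.two_le; omega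
  have hqj : q ^ j ≤ R / M := Nat.pow_log_le_self q hRM0
  have hlt : R / M < q ^ (j + 1) := Nat.lt_pow_succ_log_self hq.one_lt _
  -- the triple `(1, q^{nj} − 1, q^{nj})` sits below the good scale `R`
  have hnj : 1 ≤ n * j := Nat.one_le_iff_ne_zero.mpr (Nat.mul_ne_zero (by omega) (by omega))
  have htri : IsABCTriple 1 (q ^ (n * j) - 1) (q ^ (n * j)) :=
    isABCTriple_one_pow_sub_one hq.two_le hnj
  have hrad : rad 1 (q ^ (n * j) - 1) (q ^ (n * j)) ≤ R :=
    calc rad 1 (q ^ (n * j) - 1) (q ^ (n * j)) ≤ M * q ^ j := hfam j hj1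
      _ ≤ M * (R / M) := Nat.mul_le_mul_left M hqj
      _ ≤ R := Nat.mul_div_le R M
  have hc := hgood 1 (q ^ (n * j) - 1) (q ^ (n * j)) htri hrad
  -- but `R < M q · q^j`
  have hRlt : R < M * q * q ^ j := by
    have h' : R < q ^ (j + 1) * M := (Nat.div_lt_iff_lt_mul hM0).mp hlt
    calc R < q ^ (j + 1) * M := h'
      _ = M * q * q ^ j := by ring
  -- pass to `ℝ`
  have hR0 : (0 : ℝ) < (R : ℝ) := by
    have : 0 < R := lt_of_lt_of_le (Nat.mul_pos hM0 hq0) hRMq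
    exact_mod_cast this
  have hRlt' : (R : ℝ) < ((M * q : ℕ) : ℝ) * (q : ℝ) ^ j := by
    have : ((R : ℕ) : ℝ) < ((M * q * q ^ j : ℕ) : ℝ) := by exact_mod_cast hRlt
    push_cast at this ⊢
    linarith
  have hc' : ((q : ℝ) ^ j) ^ n ≤ (R : ℝ) ^ (1 + δ) := by
    have eq : ((q : ℝ) ^ j) ^ n = ((q ^ (n * j) : ℕ) : ℝ) := by
      push_cast
      rw [← pow_mul, mul_comm]
    rw [eq]
    exact hc
  -- `R^n < K · R^{1+δ}`
  have hpow : (R : ℝ) ^ n < K * (R : ℝ) ^ (1 + δ) := by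
    have h3 : (R : ℝ) ^ n < (((M * q : ℕ) : ℝ) * (q : ℝ) ^ j) ^ n :=
      pow_lt_pow_left₀ hRlt' hR0.le (by omega)
    calc (R : ℝ) ^ n < (((M * q : ℕ) : ℝ) * (q : ℝ) ^ j) ^ n := h3
      _ = K * ((q : ℝ) ^ j) ^ n := by rw [hK, mul_pow]
      _ ≤ K * (R : ℝ) ^ (1 + δ) := mul_le_mul_of_nonneg_left hc' hK0.le
  -- `R^e < K`
  have hsplit : (R : ℝ) ^ n = (R : ℝ) ^ (1 + δ) * (R : ℝ) ^ e := by
    rw [← Real.rpow_add hR0, ← Real.rpow_natCast]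
    congr 1
    rw [he]; ring
  have hpow1 : (0 : ℝ) < (R : ℝ) ^ (1 + δ) := Real.rpow_pos_of_pos hR0 _
  have hRe : (R : ℝ) ^ e < K := by
    rw [hsplit, mul_comm K] at hpow
    exact lt_of_mul_lt_mul_left hpow hpow1.le
  -- `R < K^{1/e}`
  have hRK : (R : ℝ) < K ^ (1 / e) := by
    have eq : (R : ℝ) = ((R : ℝ) ^ e) ^ (1 / e) := by
      rw [← Real.rpow_mul hR0.le]
      have : e * (1 / e) = 1 := by field_simp
      rw [this, Real.rpow_one]
    rw [eq]
    exact Real.rpow_lt_rpow (Real.rpow_nonneg hR0.le _) hRe (by positivity)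
  have hN₁' : (N₁ : ℝ) ≤ (R : ℝ) := by exact_mod_cast hRN₁
  linarith

/-- **Rung `n = 2`: good scales for one exponent `δ < 1` force infinitely many non-Wieferich
primes in every prime base.**  If for some `δ < 1` there are arbitrarily large scales `R` at
which every abc triple of radical `≤ R` has `c ≤ R^{1+δ}`, then for every prime `q` the set of
primes `p` with `¬ q^{p−1} ≡ 1 [MOD p²]` is infinite (level `< 2` at an odd prime `p ∤ q` means
non-Wieferich; the primes `2` and `q` are discarded). [cite: Silverman1988, Thm 1] -/
theorem sparseGoodScales_infinite_not_isWieferich_of_goodScales {δ : ℝ} (hδ : δ < 1)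
    (h : ∀ N : ℕ, ∃ R : ℕ, N ≤ R ∧ ∀ a b c : ℕ, IsABCTriple a b c → rad a b c ≤ R →
      (c : ℝ) ≤ (R : ℝ) ^ (1 + δ))
    (q : ℕ) (hq : q.Prime) : {p : ℕ | p.Prime ∧ ¬ IsWieferich q p}.Infinite := by
  have h2 : (1 : ℝ) + δ < ((2 : ℕ) : ℝ) := by push_cast; linarith
  have hlad := sparseGoodScales_infinite_wieferichLevel_lt_of_goodScales (by norm_num) h2 h q hq
  -- discard the finitely many primes `≤ max 2 q`
  refine ((hlad.sdiff (Set.finite_le_nat (max 2 q))).mono ?_)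
  rintro p ⟨⟨hp, hlev⟩, hbig⟩
  simp only [Set.mem_setOf_eq, not_le] at hbig
  have hp2 : p ≠ 2 := by
    rintro rfl
    have := le_max_left 2 q
    omega
  have hpq : ¬ p ∣ q := by
    intro hd
    have hle : p ≤ q := Nat.le_of_dvd hq.pos hd
    have := le_max_right 2 q
    omega
  exact ⟨hp, not_isWieferich_of_wieferichLevel_le_one hq.two_le hp hp2 hpq (by omega)⟩

/-- **The Wieferich floor of the crux, whole ladder.**  `SparseGoodScales` (stmt-ABC-2161)
implies that for every prime `q` and every level `E ≥ 1` there are infinitely many primes of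
Wieferich level `≤ E` to base `q` (use the good scales of exponent `δ = 1/2 < E`). Every rung is
an open problem. [cite: Silverman1988, Thm 1] -/
theorem sparseGoodScales_imp_infinite_wieferichLevel_le (h : SparseGoodScales) (q : ℕ)
    (hq : q.Prime) (E : ℕ) (hE : 1 ≤ E) :
    {p : ℕ | p.Prime ∧ wieferichLevel q p ≤ E}.Infinite := by
  have hE' : (1 : ℝ) + 1 / 2 < ((E + 1 : ℕ) : ℝ) := by
    have : (1 : ℝ) ≤ E := by exact_mod_cast hE
    push_cast; linarith
  have hlad := sparseGoodScales_infinite_wieferichLevel_lt_of_goodScales (by omega) hE'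
    (h (1 / 2) (by norm_num)) q hq
  refine hlad.mono ?_
  rintro p ⟨hp, hlt⟩
  exact ⟨hp, by omega⟩

/-- **The Wieferich floor of the crux.**  `SparseGoodScales` (stmt-ABC-2161) implies that for
every prime `q` there are infinitely many primes `p` which are not Wieferich to base `q` — the
conclusion of Silverman's abc ⟹ non-Wieferich theorem (J. Number Theory 30 (1988), Thm 1), open
unconditionally in every base; already the instance `δ = 1/2` of the crux suffices. So every proof
of the crux proves the infinitude of non-Wieferich primes (base `2` included).  (The statement is
kept on one line: it is the signature registered on stmt-ABC-2161 for this sub-goal.)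
[cite: Silverman1988, Thm 1] -/
theorem sparseGoodScales_imp_infinite_not_isWieferich : Summit.ABC.ABC.Theses.FeketeScales.SparseGoodScales → ∀ q : ℕ, q.Prime → {p : ℕ | p.Prime ∧ ¬ Literature.NumberTheory.DiophantineGeometry.IsWieferich q p}.Infinite :=
  fun h q hq =>
    sparseGoodScales_infinite_not_isWieferich_of_goodScales (by norm_num : (1 / 2 : ℝ) < 1)
      (h (1 / 2) (by norm_num)) q hq

end Summit.ABC.ABC.Theorems

end
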